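import Literature.NumberTheory.LFunctions.CentralValueFamilyForcedSplit
import Literature.NumberTheory.LFunctions.IwaniecSarnakFamilyWeightTwo
import HarnessLib

/-!
# The forced split at RESULT level over the PRINTED moment shape (total mass, non-trivial twists)
# (Iwaniec 2006 §7 (7.3)–(7.7); T-fam-KILL-2 re-derived — rider W5 of the B-fam referee)

Topic `Literature/NumberTheory/LFunctions` (namespace
`Literature.NumberTheory.LFunctions.CentralValueFamilyHalfEdge`). PROVED, elementary; NO named fact
(D-0026). Written for the cell `landau-siegel` (§C typing for §B-fam / §E), on the referee's word
ls-B-ref-3 2026-08-26T20:33:44Z («GO for the re-derivation over MixedOverTotalMass + EvenShare»).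

WHY: the landed result-level packaging `CentralValueFamily.goodMass_le_of_mixedOverMass` and its
`𝓗_k(N)` pin `goodMass_le_half_iwaniecSarnakFamily` (`CentralValueFamilyForcedSplit`) take the
hypothesis shape `MixedOverMass δ`, which includes the trivial twist `D = 1` and is therefore
CONTRADICTORY on `𝓗_k(N)` together with positive even mass (`CentralValueFamilyNontrivialTwist`,
`iwaniecSarnakFamily_not_mixedOverMass`: Mathlib's `ζ(1) < 0`). The POINTWISE algebraic lemma
`goodMass_le_of_twisted_of_mixed` is unaffected. Here the packaging is re-derived over the PRINTED
shape `MixedOverTotalMass δ` ((7.3)+(7.4) against the TOTAL mass, genuine `χ_D`, `1 < D`; for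
`𝓗_k(N)` = the named fact `IwaniecSarnak.iwaniec2006_mixedMomentOverMass`):

1. `goodMass_le_of_twisted_of_mixedTotal` (pointwise, algebraic): a mixed-moment bound by ANY
   `T ≥ 0` forces `goodMass ≤ (1 − p₂)·evenMass + T·(log |P|)^{2a}`.
2. `goodMass_le_of_mixedOverTotalMass` (shapes): `NonnegOn ∧ MixedOverTotalMass δ ∧ TwistedHalf p₂ a δ`
   ⇒ for all large admissible `P` and compatible genuine `χ_D`, `1 < D ≤ |P|^δ`:
   `goodMass a P ≤ (1 − p₂)·evenMass P + C·L(1,χ)·(log |P|)^{2a}·totalMass P` — NO even-share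
   hypothesis; this is the honest content of «the excess over 50 % disappears» for every method.
3. `goodMass_le_of_mixedOverTotalMass_of_evenShare`: with `EvenShare` (`Σ_{even} ω ≥ c·Σ ω > 0`)
   the proportion form `goodMass ≤ (1 − p₂ + C·L(1,χ)(log |P|)^{2a})·evenMass`.
4. `𝓗_k(N)` pins: `goodMass_le_half_total_iwaniecSarnakFamily` (every even `k ≥ 2`, all large
   squarefree `N`, genuine `χ_D` — hypotheses: LR03, `iwaniec2006_twistedHalf`,
   `iwaniec2006_mixedMomentOverMass`; all typed print), and the weight-2 prime-level proportion
   form `goodMass_le_half_weightTwo_prime` (adds the Petersson facts `kowalskiMichel2000_petersson`,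
   `kowalskiMichel2000_lemma1`, which give the even share — `evenShare_primeLevelFamilyTwo`).

SOURCE OF THE EVEN SHARE (referee's request): for `𝓗_k(N)`, `N` squarefree, the NATURAL count
`|H_k^±(N)| = (k−1)φ(N)/24 + O((kN)^{5/6})` is Iwaniec–Luo–Sarnak, Publ. IHES 91 (2000), Cor. 2.14
(2.73) [numdam PDF p. 81]; the HARMONIC-weight share is a DERIVATION (label S): at prime level and
weight 2 it is PROVED in `IwaniecSarnakFamilyWeightTwo` from Kowalski–Michel's Petersson formula
(display after (16)) and Lemma 1; for general `(k, N squarefree)` it would follow from ILS §2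
(Props. 2.8–2.11, newform Petersson formula) — not typed.

WHAT THIS IS NOT: no claim about Landau–Siegel zeros or about the truth of any proportion `> ½`.
«The programme SEARCHES and TYPES; no claim about Landau–Siegel zeros, Theorems 1–2 of
arXiv:2211.02515 or a repaired Margin232 until a kernel theorem says so.»

## References

* [IwaniecConversations2006] H. Iwaniec, LNM 1891 (2006), §7 (7.3)–(7.7), p. 97 (held p0095–p0097).
* [KowalskiMichel2000] Acta Arith. 94 (2000), §2.3 display after (16), Lemma 1 (typed facts).
* Tree: `CentralValueFamilyForcedSplit` (p463559), `CentralValueFamilyNontrivialTwist`,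
  `IwaniecSarnakFamilyWeightTwo`, `FamilyNonvanishingLandauSiegel`.
-/

noncomputable section

namespace Literature.NumberTheory.LFunctions.CentralValueFamilyHalfEdge

open scoped MatrixGroups
open Finset Real CongruenceSubgroup
open Literature.NumberTheory.EllipticCurves.ModularForms
open Literature.NumberTheory.LFunctions.IwaniecSarnak

namespace CentralValueFamily

variable {𝓕 : CentralValueFamily}

/-- Under `NonnegOn`, the (7.5)-mass is at most the even mass. [cite: IwaniecConversations2006, §7 (7.5)] -/
theorem goodMass_le_evenMass (hnn : 𝓕.NonnegOn) (a : ℕ) (P : 𝓕.Param) :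
    𝓕.goodMass a P ≤ 𝓕.evenMass P := by
  classical
  unfold goodMass evenMass
  refine Finset.sum_le_sum_of_subset_of_nonneg (Finset.filter_subset _ _) fun f hf _ => ?_
  exact (hnn P f (Finset.mem_filter.1 hf).1).1

/-- **The forced split, pointwise, TOTAL form.** Non-negative weights and statistics, `|P| > 1`, the
twisted proportion `≥ p₂` at `P`, and the mixed moment `≤ T` for some `T ≥ 0` force
`goodMass a P ≤ (1 − p₂)·evenMass P + T·(log |P|)^{2a}` (if the even mass vanishes both sides are
trivial; else `goodMass_le_of_twisted_of_mixed` with `M = T / evenMass P`).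
[cite: IwaniecConversations2006, §7 (7.3)–(7.7) and p. 97] -/
theorem goodMass_le_of_twisted_of_mixedTotal (hnn : 𝓕.NonnegOn) {P : 𝓕.Param} {D : ℕ} [NeZero D]
    {χ : DirichletCharacter ℂ D} (hprim : χ.IsPrimitive) (hquad : MulChar.IsQuadratic χ)
    (hcomp : 𝓕.Compatible P χ) (hsize : 1 < 𝓕.size P) (a : ℕ) {p₂ T : ℝ}
    (htw : p₂ * 𝓕.evenMass P ≤ 𝓕.goodTwistedMass a P χ)
    (hmixT : 𝓕.mixedMoment P χ ≤ T) (hT : 0 ≤ T) :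
    𝓕.goodMass a P ≤ (1 - p₂) * 𝓕.evenMass P + T * Real.log (𝓕.size P) ^ (2 * a) := by
  have hE0 : 0 ≤ 𝓕.evenMass P := 𝓕.evenMass_nonneg hnn P
  have hlog : 0 ≤ Real.log (𝓕.size P) ^ (2 * a) := pow_nonneg (Real.log_pos hsize).le _
  rcases hE0.lt_or_eq with hEpos | hE0'
  · have hmix : 𝓕.mixedMoment P χ ≤ T / 𝓕.evenMass P * 𝓕.evenMass P := by
      rwa [div_mul_cancel₀ _ hEpos.ne']
    have h := 𝓕.goodMass_le_of_twisted_of_mixed hnn hprim hquad hcomp hsize a htw hmix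
    have e : (1 - p₂ + T / 𝓕.evenMass P * Real.log (𝓕.size P) ^ (2 * a)) * 𝓕.evenMass P =
        (1 - p₂) * 𝓕.evenMass P + T * Real.log (𝓕.size P) ^ (2 * a) := by
      field_simp
    linarith [h, e.le, e.ge]
  · have hg : 𝓕.goodMass a P ≤ 0 := by rw [hE0']; exact goodMass_le_evenMass hnn a P
    rw [← hE0']
    nlinarith [mul_nonneg hT hlog]

/-- **The forced split in the PRINTED shapes (total mass, genuine `χ_D`).** `NonnegOn`, the printed
moment shape `MixedOverTotalMass δ` (constant `C`) and the twisted half `TwistedHalf p₂ a δ` give, for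
all large admissible `P` and all real primitive compatible `χ mod D` with `1 < D ≤ |P|^δ`:
`goodMass a P ≤ (1 − p₂)·evenMass P + C·L(1,χ)·(log |P|)^{2a}·totalMass P`. No even-share
hypothesis: where `L(1,χ_D)(log |P|)^{2a}·(total/even)` is small the (7.5)-good even mass cannot
exceed the fraction `1 − p₂` of the even mass — «the excess over 50% disappears» (p. 97), for every
method. [cite: IwaniecConversations2006, §7 p. 97] -/
theorem goodMass_le_of_mixedOverTotalMass (hnn : 𝓕.NonnegOn) {p₂ δ : ℝ} {a : ℕ}
    (htot : 𝓕.MixedOverTotalMass δ) (htw : 𝓕.TwistedHalf p₂ a δ) :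
    ∃ C : ℝ, 0 < C ∧ ∃ s₀ : ℝ, ∀ P : 𝓕.Param, 𝓕.Admissible P → s₀ ≤ 𝓕.size P →
      ∀ (D : ℕ) [NeZero D] (χ : DirichletCharacter ℂ D), χ.IsPrimitive → MulChar.IsQuadratic χ →
        1 < D → (D : ℝ) ≤ 𝓕.size P ^ δ → 𝓕.Compatible P χ →
          𝓕.goodMass a P ≤ (1 - p₂) * 𝓕.evenMass P +
            C * (χ.LFunction 1).re * Real.log (𝓕.size P) ^ (2 * a) * 𝓕.totalMass P := by
  obtain ⟨C, hC, s₁, hs₁⟩ := htot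
  obtain ⟨s₂, hs₂⟩ := htw
  refine ⟨C, hC, max (max s₁ s₂) 2, fun P hadm hsz D _ χ hprim hquad hD hDle hcomp => ?_⟩
  have h1 : s₁ ≤ 𝓕.size P := le_trans (le_trans (le_max_left _ _) (le_max_left _ _)) hsz
  have h2 : s₂ ≤ 𝓕.size P := le_trans (le_trans (le_max_right _ _) (le_max_left _ _)) hsz
  have hsize : 1 < 𝓕.size P := lt_of_lt_of_le (by norm_num) (le_trans (le_max_right _ _) hsz)
  have hmixT := hs₁ P hadm h1 D χ hprim hquad hD hDle hcomp
  have hT : 0 ≤ C * 𝓕.totalMass P * (χ.LFunction 1).re :=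
    le_trans (mixedMoment_nonneg_of_nonnegOn hnn P χ hprim hquad hcomp) hmixT
  have h := 𝓕.goodMass_le_of_twisted_of_mixedTotal hnn hprim hquad hcomp hsize a
    (hs₂ P hadm h2 D χ hprim hquad hDle hcomp) hmixT hT
  have e : C * 𝓕.totalMass P * (χ.LFunction 1).re * Real.log (𝓕.size P) ^ (2 * a) =
      C * (χ.LFunction 1).re * Real.log (𝓕.size P) ^ (2 * a) * 𝓕.totalMass P := by ring
  linarith [h, e.le]

/-- **The forced split, proportion form, from the printed shape AND an even share.** With `EvenShare`
(`Σ_{even} ω ≥ c·Σ ω > 0` at large admissible `P`), `NonnegOn`, `MixedOverTotalMass δ` and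
`TwistedHalf p₂ a δ` give, for all large admissible `P` and compatible genuine `χ_D`, `1 < D ≤ |P|^δ`:
`goodMass a P ≤ (1 − p₂ + C'·L(1,χ)·(log |P|)^{2a})·evenMass P`. (Run the landed
`goodMass_le_of_mixedOverMass` on the refinement `𝓕.refine ⊤ (1 < ·)`, where the trivial twist is not
compatible and `MixedOverMass` follows from the total shape and the even share.)
[cite: IwaniecConversations2006, §7 p. 97] -/
theorem goodMass_le_of_mixedOverTotalMass_of_evenShare (hnn : 𝓕.NonnegOn) (hsh : 𝓕.EvenShare)
    {p₂ δ : ℝ} {a : ℕ} (htot : 𝓕.MixedOverTotalMass δ) (htw : 𝓕.TwistedHalf p₂ a δ) :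
    ∃ C : ℝ, 0 < C ∧ ∃ s₀ : ℝ, ∀ P : 𝓕.Param, 𝓕.Admissible P → s₀ ≤ 𝓕.size P →
      ∀ (D : ℕ) [NeZero D] (χ : DirichletCharacter ℂ D), χ.IsPrimitive → MulChar.IsQuadratic χ →
        1 < D → (D : ℝ) ≤ 𝓕.size P ^ δ → 𝓕.Compatible P χ →
          𝓕.goodMass a P ≤
            (1 - p₂ + C * (χ.LFunction 1).re * Real.log (𝓕.size P) ^ (2 * a)) * 𝓕.evenMass P := by
  have hnn' := refine_nonnegOn (A := fun _ => True) (B := fun D => 1 < D) hnn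
  obtain ⟨C, hC, s₀, h⟩ := (𝓕.refine (fun _ => True) (fun D => 1 < D)).goodMass_le_of_mixedOverMass
    hnn' (mixedOverMass_of_total hnn' (fun _ _ _ _ hc => refine_compatible_B hc) (refine_evenShare hsh)
      (refine_mixedOverTotalMass htot)) (refine_twistedHalf htw)
  exact ⟨C, hC, s₀, fun P hadm hsz D _ χ hprim hquad hD hDle hcomp =>
    h P ⟨hadm, trivial⟩ hsz D χ hprim hquad hDle ⟨hcomp, hD⟩⟩

end CentralValueFamily

/-! ## The `𝓗_k(N)` pins -/

section HeckeFamily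

variable {k : ℤ}

/-- **T-fam-KILL-2, result level, TOTAL-MASS FORM, for `𝓗_k(N)` — all hypotheses typed print.** Fix
`k ≥ 2` even. Assume `lapidRallis2003_theorem1_gl2Twist` (non-negativity), `iwaniec2006_twistedHalf`
((7.6) at `½`) and `iwaniec2006_mixedMomentOverMass` ((7.3)+(7.4), constant `C`). Then for every
`ε > 0` there is `δ > 0` such that for all large squarefree `N` and all real primitive `χ mod D`,
`1 < D ≤ N^δ`, `(N,D) = 1`, `χ(−N) = 1`:
`Σ^h_{w_f = 1, L(½,f) ≥ (log N)⁻²} ω_f ≤ (½ + ε)·Σ^h_{w_f = 1} ω_f + C·L(1,χ)·(log N)⁴·Σ^h_{f} ω_f`.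
Non-vacuous replacement of `goodMass_le_half_iwaniecSarnakFamily`.
[cite: IwaniecConversations2006, §7 p. 97] -/
theorem goodMass_le_half_total_iwaniecSarnakFamily (hk : 2 ≤ k) (hkev : Even k)
    (hLR : lapidRallis2003_theorem1_gl2Twist) (hTw : iwaniec2006_twistedHalf)
    (hMix : iwaniec2006_mixedMomentOverMass) {ε : ℝ} (hε : 0 < ε) :
    ∃ C : ℝ, 0 < C ∧ ∃ δ : ℝ, 0 < δ ∧ ∃ s₀ : ℝ, ∀ N : ℕ+, Squarefree (N : ℕ) →
      s₀ ≤ ((N : ℕ) : ℝ) →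
        ∀ (D : ℕ) [NeZero D] (χ : DirichletCharacter ℂ D), χ.IsPrimitive → MulChar.IsQuadratic χ →
          1 < D → (D : ℝ) ≤ ((N : ℕ) : ℝ) ^ δ → (N : ℕ).Coprime D ∧ χ (-((N : ℕ) : ZMod D)) = 1 →
            harmonicSum (N : ℕ) k
                (fun f => if rootNumber f = 1 ∧ (Real.log (N : ℕ))⁻¹ ^ 2 ≤ (centralValue f).re
                  then 1 else 0) ≤
              (1 / 2 + ε) * harmonicSum (N : ℕ) k (fun f => if rootNumber f = 1 then 1 else 0) +
                C * (χ.LFunction 1).re * Real.log ((N : ℕ) : ℝ) ^ 4 *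
                  harmonicSum (N : ℕ) k (fun _ => 1) := by
  obtain ⟨δ₁, hδ₁, htot⟩ := mixedOverTotalMass_iwaniecSarnakFamily hk hkev hMix
  obtain ⟨δ₂, hδ₂, htw⟩ := TwistedHalf_of_twistedProportion hε (hTw k hk hkev)
  have htot' : (iwaniecSarnakFamily k).MixedOverTotalMass (min δ₁ δ₂) := htot.anti (min_le_left _ _)
  have htw' : (iwaniecSarnakFamily k).TwistedHalf (1 / 2 - ε) 2 (min δ₁ δ₂) :=
    htw.anti (min_le_right _ _)
  obtain ⟨C, hC, s₀, hs₀⟩ := (iwaniecSarnakFamily k).goodMass_le_of_mixedOverTotalMass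
    (iwaniecSarnakFamily_nonnegOn hk hLR) htot' htw'
  refine ⟨C, hC, min δ₁ δ₂, lt_min hδ₁ hδ₂, s₀, fun N hsq hN D _ χ hprim hquad hD hDle hcomp => ?_⟩
  have h := hs₀ N hsq hN D χ hprim hquad hD hDle hcomp
  rw [goodMass_iwaniecSarnakFamily N, evenMass_iwaniecSarnakFamily N,
    totalMass_iwaniecSarnakFamily N] at h
  have e : (1 - (1 / 2 - ε) : ℝ) = 1 / 2 + ε := by ring
  simpa only [e, show (2 * 2 : ℕ) = 4 from rfl] using h

/-- **T-fam-KILL-2, result level, PROPORTION FORM at prime level and weight `2` — all hypotheses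
typed print.** Assume `lapidRallis2003_theorem1_gl2Twist`, `iwaniec2006_twistedHalf`,
`iwaniec2006_mixedMomentOverMass`, and the Petersson facts `kowalskiMichel2000_petersson`,
`kowalskiMichel2000_lemma1` (which give the even harmonic share at prime level,
`evenShare_primeLevelFamilyTwo`). Then for every `ε > 0` there is `δ > 0` such that for all large
PRIME levels `q` and all real primitive `χ mod D`, `1 < D ≤ q^δ`, `(q,D) = 1`, `χ(−q) = 1`:
`Σ^h_{w_f = 1, L(½,f) ≥ (log q)⁻²} ω_f ≤ (½ + ε + C·L(1,χ)·(log q)⁴)·Σ^h_{w_f = 1} ω_f` over `H_2(q)` — at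
compatible prime levels of an exceptional `χ_D` the (7.5)-proportion is `≤ ½ + o(1)`.
[cite: IwaniecConversations2006, §7 p. 97] -/
theorem goodMass_le_half_weightTwo_prime (hLR : lapidRallis2003_theorem1_gl2Twist)
    (hTw : iwaniec2006_twistedHalf) (hMix : iwaniec2006_mixedMomentOverMass)
    (hP : KowalskiMichel2000.kowalskiMichel2000_petersson)
    (hL : KowalskiMichel2000.kowalskiMichel2000_lemma1) {ε : ℝ} (hε : 0 < ε) :
    ∃ C : ℝ, 0 < C ∧ ∃ δ : ℝ, 0 < δ ∧ ∃ s₀ : ℝ, ∀ N : ℕ+, (N : ℕ).Prime →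
      s₀ ≤ ((N : ℕ) : ℝ) →
        ∀ (D : ℕ) [NeZero D] (χ : DirichletCharacter ℂ D), χ.IsPrimitive → MulChar.IsQuadratic χ →
          1 < D → (D : ℝ) ≤ ((N : ℕ) : ℝ) ^ δ → (N : ℕ).Coprime D ∧ χ (-((N : ℕ) : ZMod D)) = 1 →
            harmonicSum (N : ℕ) 2
                (fun f => if rootNumber f = 1 ∧ (Real.log (N : ℕ))⁻¹ ^ 2 ≤ (centralValue f).re
                  then 1 else 0) ≤
              (1 / 2 + ε + C * (χ.LFunction 1).re * Real.log ((N : ℕ) : ℝ) ^ 4) *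
                harmonicSum (N : ℕ) 2 (fun f => if rootNumber f = 1 then 1 else 0) := by
  have hk : (2 : ℤ) ≤ 2 := le_rfl
  have hkev : Even (2 : ℤ) := ⟨1, rfl⟩
  obtain ⟨δ₁, hδ₁, htot⟩ := mixedOverTotalMass_iwaniecSarnakFamily hk hkev hMix
  obtain ⟨δ₂, hδ₂, htw⟩ := TwistedHalf_of_twistedProportion hε (hTw 2 hk hkev)
  have htot' : primeLevelFamilyTwo.MixedOverTotalMass (min δ₁ δ₂) :=
    CentralValueFamily.refine_mixedOverTotalMass (htot.anti (min_le_left _ _))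
  have htw' : primeLevelFamilyTwo.TwistedHalf (1 / 2 - ε) 2 (min δ₁ δ₂) :=
    CentralValueFamily.refine_twistedHalf (htw.anti (min_le_right _ _))
  have hnn := primeLevelFamilyTwo_nonnegOn hLR
  obtain ⟨C, hC, s₀, hs₀⟩ := primeLevelFamilyTwo.goodMass_le_of_mixedOverMass hnn
    (CentralValueFamily.mixedOverMass_of_total hnn
      (fun _ _ _ _ hc => CentralValueFamily.refine_compatible_B hc)
      (evenShare_primeLevelFamilyTwo hP hL) htot') htw'
  refine ⟨C, hC, min δ₁ δ₂, lt_min hδ₁ hδ₂, s₀,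
    fun N hprime hN D _ χ hprim hquad hD hDle hcomp => ?_⟩
  have h := hs₀ N ⟨hprime.squarefree, hprime⟩ hN D χ hprim hquad hDle ⟨hcomp, hD⟩
  rw [CentralValueFamily.refine_goodMass, CentralValueFamily.refine_evenMass,
    CentralValueFamily.refine_size, goodMass_iwaniecSarnakFamily N, evenMass_iwaniecSarnakFamily N] at h
  have e : (1 - (1 / 2 - ε) : ℝ) = 1 / 2 + ε := by ring
  simpa only [e, show (2 * 2 : ℕ) = 4 from rfl] using h

end HeckeFamily

end Literature.NumberTheory.LFunctions.CentralValueFamilyHalfEdge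

end
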